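import Summits.Langlands.Langlands.Theses.RationalPeriodQuarter
import Literature.NumberTheory.Automorphic.BLZPeriodCocycle
import Literature.NumberTheory.Automorphic.PiecewiseRational

/-!
# Birth skeleton — piece `HeckeStableQuarterForms` of the decomposition of `HeckePreservesRationalPeriods`
(route RationalPeriodQuarter, parent crux stmt-Langlands-2807; strategist planner-cstrat-stmt-Langlands-2807-r1-0)

Three registered stubs — the three analytic clauses of "`T'_p u` is a quarter cusp form" (`C²`;
`Γ₁(N)`-invariance = the coset permutation of Diamond–Shurman Prop. 5.2.1 in weight `0`;
the eigen-equation = `GL₂⁺(ℝ)`-invariance of the hyperbolic Laplacian, in the tree as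
`hypLaplacian_comp_smul` / `hypLaplacian_finset_sum`) — and the kernel-checked composition
`HeckeStableQuarterForms_of`, which also discharges the fourth clause (boundedness) outright.
Sorries ONLY inside `stub_*`.
-/

noncomputable section

set_option linter.dupNamespace false

namespace Summit.Langlands.Langlands.Cruxes.HeckePreservesRationalPeriods.BirthHeckeStableQuarterForms

open scoped MatrixGroups
open Literature.NumberTheory.Automorphic

/-- The piece, verbatim (child `HeckeStableQuarterForms`; not yet a route decl). -/
def HeckeStableQuarterForms : Prop :=
  let IsQuarterCuspForm : ℕ → (UpperHalfPlane → ℂ) → Prop := fun N u => Literature.NumberTheory.Automorphic.IsC2 u ∧ (∀ γ ∈ CongruenceSubgroup.Gamma1 N, ∀ z : UpperHalfPlane, u (γ • z) = u z) ∧ (∀ z : UpperHalfPlane, Literature.NumberTheory.Automorphic.hypLaplacian u z + (1 / 4 : ℂ) * u z = 0) ∧ ∃ C : ℝ, ∀ z : UpperHalfPlane, ‖u z‖ ≤ C; ∀ N : ℕ, 0 < N → ∀ p : ℕ, p.Prime → ¬ p ∣ N → ∀ σ ∈ CongruenceSubgroup.Gamma0 N, (((σ : Matrix (Fin 2) (Fin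 2) ℤ) 1 1 : ℤ) : ZMod N) = (p : ZMod N) → ∀ u : UpperHalfPlane → ℂ, IsQuarterCuspForm N u → IsQuarterCuspForm N (fun z : UpperHalfPlane => ((Real.sqrt p : ℝ) : ℂ)⁻¹ * (∑ b ∈ Finset.range p, u (UpperHalfPlane.ofComplex (((z : ℂ) + b) / p)) + u (σ • UpperHalfPlane.ofComplex ((p : ℂ) * (z : ℂ)))))

/-- The route's `IsQuarterCuspForm` (verbatim). -/
def IsQuarterCuspFormB : ℕ → (UpperHalfPlane → ℂ) → Prop := fun N u => Literature.NumberTheory.Automorphic.IsC2 u ∧ (∀ γ ∈ CongruenceSubgroup.Gamma1 N, ∀ z : UpperHalfPlane, u (γ • z) = u z) ∧ (∀ z : UpperHalfPlane, Literature.NumberTheory.Automorphic.hypLaplacian u z + (1 / 4 : ℂ) * u z = 0) ∧ ∃ C : ℝ, ∀ z : UpperHalfPlane, ‖u z‖ ≤ C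

/-- The route's `T'_p` (verbatim). -/
def heckeTB (p : ℕ) (σ : SL(2, ℤ)) (u : UpperHalfPlane → ℂ) : UpperHalfPlane → ℂ := (fun z : UpperHalfPlane => ((Real.sqrt p : ℝ) : ℂ)⁻¹ * (∑ b ∈ Finset.range p, u (UpperHalfPlane.ofComplex (((z : ℂ) + b) / p)) + u (σ • UpperHalfPlane.ofComplex ((p : ℂ) * (z : ℂ)))))

theorem heckeStableQuarterForms_iff : HeckeStableQuarterForms ↔
    ∀ N : ℕ, 0 < N → ∀ p : ℕ, p.Prime → ¬ p ∣ N → ∀ σ ∈ CongruenceSubgroup.Gamma0 N,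
      (((σ : Matrix (Fin 2) (Fin 2) ℤ) 1 1 : ℤ) : ZMod N) = (p : ZMod N) → ∀ u : UpperHalfPlane → ℂ,
        IsQuarterCuspFormB N u → IsQuarterCuspFormB N (heckeTB p σ u) := Iff.rfl

/-- **stub_isC2** (`T'_p u` is `C²`: compositions of `u` with the Möbius maps `(z+b)/p`, `σ(pz)` and
finite sums; tree: `contDiffOn_smulExtend`, `isC2_finset_sum`). [cite: Iwaniec2002, (1.22)] -/
theorem stub_isC2 : ∀ (p : ℕ) (σ : SL(2, ℤ)) (u : UpperHalfPlane → ℂ), p.Prime →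
    Literature.NumberTheory.Automorphic.IsC2 u → Literature.NumberTheory.Automorphic.IsC2 (fun z : UpperHalfPlane => ((Real.sqrt p : ℝ) : ℂ)⁻¹ * (∑ b ∈ Finset.range p, u (UpperHalfPlane.ofComplex (((z : ℂ) + b) / p)) + u (σ • UpperHalfPlane.ofComplex ((p : ℂ) * (z : ℂ))))) := by
  sorry

/-- **stub_invariant** (`Γ₁(N)`-invariance of `T'_p u`: right multiplication by `γ ∈ Γ₁(N)` permutes
the cosets `Γ₁(N)(1 b; 0 p)`, `Γ₁(N)σ(p 0; 0 1)`; Diamond–Shurman Prop. 5.2.1).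
[cite: DiamondShurman2005, Prop. 5.2.1] -/
theorem stub_invariant : ∀ N : ℕ, 0 < N → ∀ p : ℕ, p.Prime → ¬ p ∣ N → ∀ σ ∈ CongruenceSubgroup.Gamma0 N,
    (((σ : Matrix (Fin 2) (Fin 2) ℤ) 1 1 : ℤ) : ZMod N) = (p : ZMod N) → ∀ u : UpperHalfPlane → ℂ,
    (∀ γ ∈ CongruenceSubgroup.Gamma1 N, ∀ z : UpperHalfPlane, u (γ • z) = u z) →
    ∀ γ ∈ CongruenceSubgroup.Gamma1 N, ∀ z : UpperHalfPlane, (fun z : UpperHalfPlane => ((Real.sqrt p : ℝ) : ℂ)⁻¹ * (∑ b ∈ Finset.range p, u (UpperHalfPlane.ofComplex (((z : ℂ) + b) / p)) + u (σ • UpperHalfPlane.ofComplex ((p : ℂ) * (z : ℂ))))) (γ • z) = (fun z : UpperHalfPlane => ((Real.sqrt p : ℝ) : ℂ)⁻¹ * (∑ b ∈ Finset.range p, u (UpperHalfPlane.ofComplex (((z : ℂ) + b) / p)) + u (σ • UpperHalfPlane.ofComplex ((p : ℂ) * (z : ℂ))))) z := by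
  sorry

/-- **stub_eigen** (the eigen-equation `Δ(T'_p u) = -(1/4) T'_p u`: invariance of `Δ` under
`GL₂⁺(ℝ)`, tree `hypLaplacian_comp_smul`, and linearity `hypLaplacian_finset_sum`).
[cite: Iwaniec2002, §1.6] -/
theorem stub_eigen : ∀ (p : ℕ) (σ : SL(2, ℤ)) (u : UpperHalfPlane → ℂ), p.Prime →
    Literature.NumberTheory.Automorphic.IsC2 u →
    (∀ z : UpperHalfPlane, Literature.NumberTheory.Automorphic.hypLaplacian u z + (1 / 4 : ℂ) * u z = 0) →
    ∀ z : UpperHalfPlane, Literature.NumberTheory.Automorphic.hypLaplacian (fun z : UpperHalfPlane => ((Real.sqrt p : ℝ) : ℂ)⁻¹ * (∑ b ∈ Finset.range p, u (UpperHalfPlane.ofComplex (((z : ℂ) + b) / p)) + u (σ • UpperHalfPlane.ofComplex ((p : ℂ) * (z : ℂ))))) z + (1 / 4 : ℂ) * (fun z : UpperHalfPlane => ((Real.sqrt p : ℝ) : ℂ)⁻¹ * (∑ b ∈ Finset.range p, u (UpperHalfPlane.ofComplex (((z : ℂ) + b) / p)) + u (σ • UpperHalfPlane.ofComplex ((p :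 ℂ) * (z : ℂ))))) z = 0 := by
  sorry

/-- **Composition**: the three stubs give the piece; boundedness of `T'_p u` is proved here
(`‖T'_p u‖ ≤ p^{-1/2} (p + 1) C`). [folklore] -/
theorem HeckeStableQuarterForms_of :
    (∀ (p : ℕ) (σ : SL(2, ℤ)) (u : UpperHalfPlane → ℂ), p.Prime →
      Literature.NumberTheory.Automorphic.IsC2 u → Literature.NumberTheory.Automorphic.IsC2 (fun z : UpperHalfPlane => ((Real.sqrt p : ℝ) : ℂ)⁻¹ * (∑ b ∈ Finset.range p, u (UpperHalfPlane.ofComplex (((z : ℂ) + b) / p)) + u (σ • UpperHalfPlane.ofComplex ((p : ℂ) * (z : ℂ)))))) →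
    (∀ N : ℕ, 0 < N → ∀ p : ℕ, p.Prime → ¬ p ∣ N → ∀ σ ∈ CongruenceSubgroup.Gamma0 N,
      (((σ : Matrix (Fin 2) (Fin 2) ℤ) 1 1 : ℤ) : ZMod N) = (p : ZMod N) → ∀ u : UpperHalfPlane → ℂ,
      (∀ γ ∈ CongruenceSubgroup.Gamma1 N, ∀ z : UpperHalfPlane, u (γ • z) = u z) →
      ∀ γ ∈ CongruenceSubgroup.Gamma1 N, ∀ z : UpperHalfPlane, (fun z : UpperHalfPlane => ((Real.sqrt p : ℝ) : ℂ)⁻¹ * (∑ b ∈ Finset.range p, u (UpperHalfPlane.ofComplex (((z : ℂ) + b) / p)) + u (σ • UpperHalfPlane.ofComplex ((p : ℂ) * (z : ℂ))))) (γ • z) = (fun z : UpperHalfPlane => ((Real.sqrt p : ℝ) : ℂ)⁻¹ * (∑ b ∈ Finset.range p, u (UpperHalfPlane.ofComplex (((z : ℂ) + b) / p)) + u (σ • UpperHalfPlane.ofComplex ((p : ℂ) * (z : ℂ))))) z) →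
    (∀ (p : ℕ) (σ : SL(2, ℤ)) (u : UpperHalfPlane → ℂ), p.Prime →
      Literature.NumberTheory.Automorphic.IsC2 u →
      (∀ z : UpperHalfPlane, Literature.NumberTheory.Automorphic.hypLaplacian u z + (1 / 4 : ℂ) * u z = 0) →
      ∀ z : UpperHalfPlane, Literature.NumberTheory.Automorphic.hypLaplacian (fun z : UpperHalfPlane => ((Real.sqrt p : ℝ) : ℂ)⁻¹ * (∑ b ∈ Finset.range p, u (UpperHalfPlane.ofComplex (((z : ℂ) + b) / p)) + u (σ • UpperHalfPlane.ofComplex ((p : ℂ) * (z : ℂ))))) z + (1 / 4 : ℂ) * (fun z : UpperHalfPlane => ((Real.sqrt p : ℝ) : ℂ)⁻¹ * (∑ b ∈ Finset.range p, u (UpperHalfPlane.ofComplex (((z : ℂ) + b) / p)) + u (σ • UpperHalfPlane.ofComplex ((p : ℂ) * (z : ℂ))))) z = 0) →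
    HeckeStableQuarterForms := by
  intro h1 h2 h3
  refine heckeStableQuarterForms_iff.mpr ?_
  intro N hN p hp hpN σ hσ hσp u hu
  obtain ⟨hC2, hinv, heig, C, hC⟩ := hu
  refine ⟨h1 p σ u hp hC2, h2 N hN p hp hpN σ hσ hσp u hinv, h3 p σ u hp hC2 heig, ?_⟩
  -- boundedness
  refine ⟨‖(((Real.sqrt p : ℝ) : ℂ)⁻¹)‖ * (∑ b ∈ Finset.range p, C + C), fun z => ?_⟩
  show ‖((Real.sqrt p : ℝ) : ℂ)⁻¹ * (∑ b ∈ Finset.range p,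
      u (UpperHalfPlane.ofComplex (((z : ℂ) + b) / p)) + u (σ • UpperHalfPlane.ofComplex ((p : ℂ) * (z : ℂ))))‖ ≤ _
  rw [norm_mul]
  refine mul_le_mul_of_nonneg_left ?_ (norm_nonneg _)
  refine (norm_add_le _ _).trans (add_le_add ((norm_sum_le _ _).trans (Finset.sum_le_sum fun b _ => hC _)) (hC _))

end Summit.Langlands.Langlands.Cruxes.HeckePreservesRationalPeriods.BirthHeckeStableQuarterForms
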